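import Literature.AlgebraicGeometry.Motives.KunnethSections
import Literature.AlgebraicGeometry.Morphisms.CechH1Refinement
import HarnessLib

/-!
# Künneth base change for Čech cochains: `Γ(U, 𝒪_X) ⊗_k Č•(𝒲, 𝒪_Y) ≅ Č•(U ×_k 𝒲, 𝒪_{X ×_k Y})`

Let `X`, `Y` be `k`-schemes, `U ⊆ X` a quasi-compact quasi-separated open and `𝒲 = (W_b)_{b ∈ B}` a
finite family of affine opens of the quasi-separated scheme `Y`. The opens `U ×_k W_b ⊆ X ×_k Y`
(`prodFamilyRight X Y U 𝒲`) form a family whose Čech complex of `𝒪_{X ×_k Y}` (`Morphisms/CechH1`)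
is, term by term, the base change `Γ(U, 𝒪_X) ⊗_k Čᵖ(𝒲, 𝒪_Y)` — the degree-`0` Künneth formula
(Görtz–Wedhorn II, Cor. 22.110 for `i = 0`, `Motives/KunnethSections`) applied to the qcqs opens
`U` and `W_{b₀} ∩ ⋯ ∩ W_{bₚ}`. This file constructs the comparison maps and proves:

* `kunnethPi` — for a finite family of opens `O_j ⊆ Y` and opens `Q_j = U ×_k O_j` of `X ×_k Y`,
  the map `Γ(U) ⊗_k Π_j Γ(O_j) → Π_j Γ(X ×_k Y, Q_j)`, `r ⊗ s ↦ (pr_X^* r · pr_Y^* s_j)_j`, and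
  its bijectivity (`kunnethPi_bijective`; tensor products commute with finite products);
* `kunnethC0`, `kunnethC1`, `kunnethC2` — the maps `Γ(U) ⊗_k Čᵖ(𝒲, 𝒪_Y) → Čᵖ(U ×_k 𝒲, 𝒪)`,
  `p = 0, 1, 2`, commuting with the differentials (`kunnethC1_lTensor_cechD0`,
  `kunnethC2_lTensor_cechD1`), `kunnethC1` bijective and `kunnethC2` injective
  (`kunnethC1_bijective`, `kunnethC2_injective`);
* `kunnethC1_one_tmul` — `1 ⊗ c ↦ pr_Y^* c` (restricted to `U ×_k 𝒲`);
* `kunnethC1_rTensor_res` — compatibility with restriction to `U' ⊆ U`.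

This is the cochain-level input of the Künneth formula in degree `1` on product coverings
(`Motives/KunnethH1ProductCover`), Görtz–Wedhorn II, Cor. 22.110. Mathlib searched (pin):
`TensorProduct.lift`, `LinearMap.lTensor`, `LinearMap.single`, `LinearMap.proj`,
`Finset.univ_sum_single` (used); `TensorProduct.piRight` (the same distributivity, not used
directly because Čech cochains are iterated `Π`-types).

## References

* U. Görtz, T. Wedhorn, *Algebraic Geometry II: Cohomology of Schemes*, Springer Spektrum (2023),
  doi:10.1007/978-3-658-43031-3: Cor. 22.110, p. 399; (22.23) (read via the held copy).
  [GortzWedhorn2023]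
* The Stacks Project, Tag 0BEC (Künneth formula). [StacksProject]
-/

universe u v

open CategoryTheory CategoryTheory.Limits AlgebraicGeometry MonoidalCategory TensorProduct
open CartesianMonoidalCategory
open Literature.AlgebraicGeometry.Morphisms

noncomputable section

namespace Literature.AlgebraicGeometry.Motives

variable {k : Type u} [Field k] (X Y : SchemeOver k)

/-! ### `Γ(U) ⊗_k Π_j Γ(O_j) → Π_j Γ(U ×_k O_j)` -/

section Pi

variable (U : X.left.Opens) {J : Type v} (O : J → Y.left.Opens) (Q : J → (X ⊗ Y).left.Opens)
  (h₁ : ∀ j, Q j ≤ (fst X Y).left ⁻¹ᵁ U) (h₂ : ∀ j, Q j ≤ (snd X Y).left ⁻¹ᵁ (O j))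

/-- **The Künneth map into a product of section rings**: for opens `Q_j ⊆ pr_X⁻¹U ∩ pr_Y⁻¹O_j` of
`X ×_k Y`, `Γ(U, 𝒪_X) ⊗_k Π_j Γ(O_j, 𝒪_Y) → Π_j Γ(Q_j, 𝒪_{X ×_k Y})`,
`r ⊗ (s_j)_j ↦ (pr_X^* r · pr_Y^* s_j)_j`. [cite: GortzWedhorn2023, (22.23) and Cor. 22.110 (p. 399)] -/
def kunnethPi : Sections X.hom U ⊗[k] (∀ j, Sections Y.hom (O j)) →ₗ[k]
    ∀ j, Sections (X ⊗ Y).hom (Q j) :=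
  TensorProduct.lift
    (LinearMap.mk₂ k
      (fun r s j =>
        Sections.comap X.hom (X ⊗ Y).hom (fst X Y).left (fst_left_comp_hom X Y) (h₁ j) r *
          Sections.comap Y.hom (X ⊗ Y).hom (snd X Y).left (snd_left_comp_hom X Y) (h₂ j) (s j))
      (fun r r' s => by funext j; simp only [map_add, add_mul, Pi.add_apply])
      (fun c r s => by funext j; simp only [map_smul, smul_mul_assoc, Pi.smul_apply])
      (fun r s s' => by funext j; simp only [Pi.add_apply, map_add, mul_add])
      (fun c r s => by funext j; simp only [Pi.smul_apply, map_smul, mul_smul_comm]))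

/-- `kunnethPi (r ⊗ s) = (pr_X^* r · pr_Y^* s_j)_j`. [folklore] -/
@[simp]
theorem kunnethPi_tmul (r : Sections X.hom U) (s : ∀ j, Sections Y.hom (O j)) (j : J) :
    kunnethPi X Y U O Q h₁ h₂ (r ⊗ₜ s) j =
      Sections.comap X.hom (X ⊗ Y).hom (fst X Y).left (fst_left_comp_hom X Y) (h₁ j) r *
        Sections.comap Y.hom (X ⊗ Y).hom (snd X Y).left (snd_left_comp_hom X Y) (h₂ j) (s j) :=
  rfl

/-- Each component of `kunnethPi` is the Künneth map on sections for `U`, `O_j` followed by the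
restriction `Γ(U ×_k O_j) → Γ(Q_j)`, applied to the `j`-th component. [folklore] -/
theorem kunnethPi_apply_eq (T : Sections X.hom U ⊗[k] (∀ j, Sections Y.hom (O j))) (j : J) :
    kunnethPi X Y U O Q h₁ h₂ T j =
      Sections.res (X ⊗ Y).hom (V := prodOpen X Y U (O j)) (W := Q j) (le_inf (h₁ j) (h₂ j))
        (kunnethSections X Y U (O j) (LinearMap.lTensor _ (LinearMap.proj j) T)) := by
  induction T using TensorProduct.induction_on with
  | zero => simp only [map_zero, Pi.zero_apply]
  | tmul r s =>
      rw [kunnethPi_tmul, LinearMap.lTensor_tmul, LinearMap.proj_apply, kunnethSections_tmul,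
        map_mul, Sections.res_comap, Sections.res_comap]
  | add x y hx hy => simp only [map_add, Pi.add_apply, hx, hy]

/-- Reassembling a tensor from its components: `T = Σ_j (id ⊗ ι_j)((id ⊗ pr_j) T)` for a finite
index type. [folklore] -/
theorem sum_lTensor_single_proj [Fintype J] [DecidableEq J]
    (T : Sections X.hom U ⊗[k] (∀ j, Sections Y.hom (O j))) :
    ∑ j, LinearMap.lTensor _ (LinearMap.single k (fun j => Sections Y.hom (O j)) j)
      (LinearMap.lTensor _ (LinearMap.proj j) T) = T := by
  induction T using TensorProduct.induction_on with
  | zero => simp only [map_zero, Finset.sum_const_zero]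
  | tmul r s =>
      simp only [LinearMap.lTensor_tmul, LinearMap.proj_apply, LinearMap.coe_single]
      rw [← tmul_sum, Finset.univ_sum_single]
  | add x y hx hy => simp only [map_add, Finset.sum_add_distrib, hx, hy]

/-- Components of a reassembled tensor. [folklore] -/
theorem lTensor_proj_lTensor_single [DecidableEq J] {j j' : J}
    (t : Sections X.hom U ⊗[k] Sections Y.hom (O j)) :
    LinearMap.lTensor _ (LinearMap.proj j')
      (LinearMap.lTensor (Sections X.hom U) (LinearMap.single k (fun j => Sections Y.hom (O j)) j)
        t) = if h : j = j' then h ▸ t else 0 := by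
  rw [← LinearMap.comp_apply, ← LinearMap.lTensor_comp]
  split_ifs with h
  · subst h
    rw [LinearMap.proj_comp_single_same, LinearMap.lTensor_id, LinearMap.id_apply]
  · rw [LinearMap.proj_comp_single_ne k _ j' j (Ne.symm h), LinearMap.lTensor_zero,
      LinearMap.zero_apply]

/-- **`Γ(U) ⊗_k Π_j Γ(O_j) → Π_j Γ(U ×_k O_j)` is bijective** for `J` finite, `U`, `O_j`
quasi-compact quasi-separated and `Q_j = U ×_k O_j` (degree-`0` Künneth,
`kunnethSections_bijective`, in each component; tensor products commute with finite products).
[cite: GortzWedhorn2023, Cor. 22.110 (p. 399), i = 0] -/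
theorem kunnethPi_bijective [Finite J] (hU : IsCompact (U : Set X.left))
    (hU' : IsQuasiSeparated (U : Set X.left)) (hO : ∀ j, IsCompact (O j : Set Y.left))
    (hO' : ∀ j, IsQuasiSeparated (O j : Set Y.left)) (h₃ : ∀ j, prodOpen X Y U (O j) ≤ Q j) :
    Function.Bijective (kunnethPi X Y U O Q h₁ h₂) := by
  classical
  cases nonempty_fintype J
  have hθ : ∀ j, Function.Bijective (kunnethSections X Y U (O j)) :=
    fun j => kunnethSections_bijective X Y hU hU' (hO j) (hO' j)
  -- the restrictions along `Q_j = U ×_k O_j` are bijective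
  have hρ : ∀ j, Function.Bijective
      (Sections.res (X ⊗ Y).hom (V := prodOpen X Y U (O j)) (W := Q j) (le_inf (h₁ j) (h₂ j))) := by
    intro j
    refine Function.bijective_iff_has_inverse.mpr
      ⟨Sections.res (X ⊗ Y).hom (V := Q j) (W := prodOpen X Y U (O j)) (h₃ j), ?_, ?_⟩
    · intro s; rw [Sections.res_res, Sections.res_self]
    · intro s; rw [Sections.res_res, Sections.res_self]
  constructor
  · intro T T' hTT'
    rw [← sub_eq_zero] at hTT' ⊢
    rw [← map_sub] at hTT'
    set D := T - T'
    have hD : ∀ j, LinearMap.lTensor _ (LinearMap.proj j) D = 0 := by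
      intro j
      have h := congrFun hTT' j
      rw [kunnethPi_apply_eq, Pi.zero_apply] at h
      have h' : kunnethSections X Y U (O j) (LinearMap.lTensor _ (LinearMap.proj j) D) = 0 :=
        (hρ j).1 (h.trans (map_zero _).symm)
      exact (hθ j).1 (h'.trans (map_zero _).symm)
    rw [← sum_lTensor_single_proj X Y U O D]
    simp only [hD, map_zero, Finset.sum_const_zero]
  · intro F
    choose t ht using fun j => ((hρ j).comp (hθ j)).2 (F j)
    refine ⟨∑ j, LinearMap.lTensor _ (LinearMap.single k (fun j => Sections Y.hom (O j)) j) (t j),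
      ?_⟩
    funext j'
    rw [kunnethPi_apply_eq, map_sum]
    simp only [lTensor_proj_lTensor_single, Finset.sum_dite_eq', Finset.mem_univ, if_true]
    exact ht j'

/-- **Naturality of `kunnethPi` in `U`**: for `U' ⊆ U` and opens `Q'_j ⊆ Q_j` over `U'`,
restricting first `r ∈ Γ(U)` to `U'` and then applying `kunnethPi` is `kunnethPi` followed by the
restrictions `Γ(Q_j) → Γ(Q'_j)`. [folklore] -/
theorem kunnethPi_rTensor_res {U' : X.left.Opens} (hU' : U' ≤ U) (Q' : J → (X ⊗ Y).left.Opens)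
    (h₁' : ∀ j, Q' j ≤ (fst X Y).left ⁻¹ᵁ U') (h₂' : ∀ j, Q' j ≤ (snd X Y).left ⁻¹ᵁ (O j))
    (hQ : ∀ j, Q' j ≤ Q j) (T : Sections X.hom U ⊗[k] (∀ j, Sections Y.hom (O j))) (j : J) :
    kunnethPi X Y U' O Q' h₁' h₂' (LinearMap.rTensor _ (Sections.res X.hom hU').toLinearMap T) j =
      Sections.res (X ⊗ Y).hom (hQ j) (kunnethPi X Y U O Q h₁ h₂ T j) := by
  induction T using TensorProduct.induction_on with
  | zero => simp only [map_zero, Pi.zero_apply]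
  | tmul r s =>
      rw [LinearMap.rTensor_tmul, kunnethPi_tmul, kunnethPi_tmul, map_mul, Sections.res_comap,
        Sections.res_comap]
      erw [Sections.comap_res]
  | add x y hx hy => simp only [map_add, Pi.add_apply, hx, hy]

end Pi

/-! ### The family `U ×_k 𝒲` and the base change of Čech cochains -/

section Cech

variable (U : X.left.Opens) {B : Type v} (W : B → Y.left.Opens)

/-- The family `(U ×_k W_b)_b` of opens of `X ×_k Y`. [folklore] -/
def prodFamilyRight : B → (X ⊗ Y).left.Opens := fun b => prodOpen X Y U (W b)

/-- Unfolding of `prodFamilyRight`. [folklore] -/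
theorem prodFamilyRight_apply (b : B) : prodFamilyRight X Y U W b = prodOpen X Y U (W b) := rfl

/-- `productFamily V W (a, b) = prodFamilyRight (V a) W b`. [folklore] -/
theorem productFamily_eq_prodFamilyRight {A : Type*} (V : A → X.left.Opens) (p : A × B) :
    productFamily X Y V W p = prodFamilyRight X Y (V p.1) W p.2 := rfl

/-- Curried double `Π`-types as single `Π`-types over pairs (linear). [folklore] -/
def piCurry₂ (S : B → B → Type*) [∀ b b', AddCommMonoid (S b b')] [∀ b b', Module k (S b b')] :
    (∀ b b', S b b') ≃ₗ[k] ∀ p : B × B, S p.1 p.2 where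
  toFun F p := F p.1 p.2
  invFun G b b' := G (b, b')
  left_inv _ := rfl
  right_inv _ := rfl
  map_add' _ _ := rfl
  map_smul' _ _ := rfl

/-- Curried triple `Π`-types as single `Π`-types over triples (linear). [folklore] -/
def piCurry₃ (S : B → B → B → Type*) [∀ b b' b'', AddCommMonoid (S b b' b'')]
    [∀ b b' b'', Module k (S b b' b'')] :
    (∀ b b' b'', S b b' b'') ≃ₗ[k] ∀ p : B × B × B, S p.1 p.2.1 p.2.2 where
  toFun F p := F p.1 p.2.1 p.2.2
  invFun G b b' b'' := G (b, b', b'')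
  left_inv _ := rfl
  right_inv _ := rfl
  map_add' _ _ := rfl
  map_smul' _ _ := rfl

/-- `U ×_k W_b ⊆ pr_X⁻¹ U`. [folklore] -/
theorem prodFamilyRight_le_fst (b : B) : prodFamilyRight X Y U W b ≤ (fst X Y).left ⁻¹ᵁ U :=
  inf_le_left

/-- `U ×_k W_b ⊆ pr_Y⁻¹ W_b`. [folklore] -/
theorem prodFamilyRight_le_snd (b : B) :
    prodFamilyRight X Y U W b ≤ (snd X Y).left ⁻¹ᵁ (W b) :=
  inf_le_right

/-- `(U ×_k W_b) ∩ (U ×_k W_{b'}) ⊆ pr_X⁻¹ U`. [folklore] -/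
theorem prodFamilyRight_inf_le_fst (b b' : B) :
    prodFamilyRight X Y U W b ⊓ prodFamilyRight X Y U W b' ≤ (fst X Y).left ⁻¹ᵁ U :=
  inf_le_left.trans inf_le_left

/-- `(U ×_k W_b) ∩ (U ×_k W_{b'}) ⊆ pr_Y⁻¹ (W_b ∩ W_{b'})`. [folklore] -/
theorem prodFamilyRight_inf_le_snd (b b' : B) :
    prodFamilyRight X Y U W b ⊓ prodFamilyRight X Y U W b' ≤ (snd X Y).left ⁻¹ᵁ (W b ⊓ W b') :=
  fun _ hx => ⟨hx.1.2, hx.2.2⟩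

/-- Triple version of `prodFamilyRight_inf_le_fst`. [folklore] -/
theorem prodFamilyRight_inf₃_le_fst (b b' b'' : B) :
    prodFamilyRight X Y U W b ⊓ prodFamilyRight X Y U W b' ⊓ prodFamilyRight X Y U W b'' ≤
      (fst X Y).left ⁻¹ᵁ U :=
  inf_le_left.trans (inf_le_left.trans inf_le_left)

/-- Triple version of `prodFamilyRight_inf_le_snd`. [folklore] -/
theorem prodFamilyRight_inf₃_le_snd (b b' b'' : B) :
    prodFamilyRight X Y U W b ⊓ prodFamilyRight X Y U W b' ⊓ prodFamilyRight X Y U W b'' ≤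
      (snd X Y).left ⁻¹ᵁ (W b ⊓ W b' ⊓ W b'') :=
  fun _ hx => ⟨⟨hx.1.1.2, hx.1.2.2⟩, hx.2.2⟩

/-- **Base change of `0`-cochains** `Γ(U) ⊗_k Č⁰(𝒲, 𝒪_Y) → Č⁰(U ×_k 𝒲, 𝒪_{X ×_k Y})`.
[cite: GortzWedhorn2023, (22.23) and Cor. 22.110 (p. 399)] -/
def kunnethC0 :
    Sections X.hom U ⊗[k] CechC0 Y.hom W →ₗ[k] CechC0 (X ⊗ Y).hom (prodFamilyRight X Y U W) :=
  kunnethPi X Y U W (prodFamilyRight X Y U W) (prodFamilyRight_le_fst X Y U W)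
    (prodFamilyRight_le_snd X Y U W)

/-- **Base change of `1`-cochains** `Γ(U) ⊗_k Č¹(𝒲, 𝒪_Y) → Č¹(U ×_k 𝒲, 𝒪_{X ×_k Y})`.
[cite: GortzWedhorn2023, (22.23) and Cor. 22.110 (p. 399)] -/
def kunnethC1 :
    Sections X.hom U ⊗[k] CechC1 Y.hom W →ₗ[k] CechC1 (X ⊗ Y).hom (prodFamilyRight X Y U W) :=
  (piCurry₂ (fun b b' => Sections (X ⊗ Y).hom
      (prodFamilyRight X Y U W b ⊓ prodFamilyRight X Y U W b'))).symm.toLinearMap ∘ₗ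
    kunnethPi X Y U (fun p : B × B => W p.1 ⊓ W p.2)
      (fun p => prodFamilyRight X Y U W p.1 ⊓ prodFamilyRight X Y U W p.2)
      (fun p => prodFamilyRight_inf_le_fst X Y U W p.1 p.2)
      (fun p => prodFamilyRight_inf_le_snd X Y U W p.1 p.2) ∘ₗ
    LinearMap.lTensor _ (piCurry₂ (fun b b' => Sections Y.hom (W b ⊓ W b'))).toLinearMap

/-- **Base change of `2`-cochains** `Γ(U) ⊗_k Č²(𝒲, 𝒪_Y) → Č²(U ×_k 𝒲, 𝒪_{X ×_k Y})`.
[cite: GortzWedhorn2023, (22.23) and Cor. 22.110 (p. 399)] -/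
def kunnethC2 :
    Sections X.hom U ⊗[k] CechC2 Y.hom W →ₗ[k] CechC2 (X ⊗ Y).hom (prodFamilyRight X Y U W) :=
  (piCurry₃ (fun b b' b'' => Sections (X ⊗ Y).hom
      (prodFamilyRight X Y U W b ⊓ prodFamilyRight X Y U W b' ⊓
        prodFamilyRight X Y U W b''))).symm.toLinearMap ∘ₗ
    kunnethPi X Y U (fun p : B × B × B => W p.1 ⊓ W p.2.1 ⊓ W p.2.2)
      (fun p => prodFamilyRight X Y U W p.1 ⊓ prodFamilyRight X Y U W p.2.1 ⊓
        prodFamilyRight X Y U W p.2.2)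
      (fun p => prodFamilyRight_inf₃_le_fst X Y U W p.1 p.2.1 p.2.2)
      (fun p => prodFamilyRight_inf₃_le_snd X Y U W p.1 p.2.1 p.2.2) ∘ₗ
    LinearMap.lTensor _
      (piCurry₃ (fun b b' b'' => Sections Y.hom (W b ⊓ W b' ⊓ W b''))).toLinearMap

/-- `kunnethC0 (r ⊗ e)_b = pr_X^* r · pr_Y^* e_b`. [folklore] -/
theorem kunnethC0_tmul (r : Sections X.hom U) (e : CechC0 Y.hom W) (b : B) :
    kunnethC0 X Y U W (r ⊗ₜ e) b =
      Sections.comap X.hom (X ⊗ Y).hom (fst X Y).left (fst_left_comp_hom X Y)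
          (prodFamilyRight_le_fst X Y U W b) r *
        Sections.comap Y.hom (X ⊗ Y).hom (snd X Y).left (snd_left_comp_hom X Y)
          (prodFamilyRight_le_snd X Y U W b) (e b) :=
  rfl

/-- `kunnethC1 (r ⊗ c)_{bb'} = pr_X^* r · pr_Y^* c_{bb'}`. [folklore] -/
theorem kunnethC1_tmul (r : Sections X.hom U) (c : CechC1 Y.hom W) (b b' : B) :
    kunnethC1 X Y U W (r ⊗ₜ c) b b' =
      Sections.comap X.hom (X ⊗ Y).hom (fst X Y).left (fst_left_comp_hom X Y)
          (prodFamilyRight_inf_le_fst X Y U W b b') r *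
        Sections.comap Y.hom (X ⊗ Y).hom (snd X Y).left (snd_left_comp_hom X Y)
          (prodFamilyRight_inf_le_snd X Y U W b b') (c b b') :=
  rfl

/-- `kunnethC2 (r ⊗ c)_{bb'b''} = pr_X^* r · pr_Y^* c_{bb'b''}`. [folklore] -/
theorem kunnethC2_tmul (r : Sections X.hom U) (c : CechC2 Y.hom W) (b b' b'' : B) :
    kunnethC2 X Y U W (r ⊗ₜ c) b b' b'' =
      Sections.comap X.hom (X ⊗ Y).hom (fst X Y).left (fst_left_comp_hom X Y)
          (prodFamilyRight_inf₃_le_fst X Y U W b b' b'') r *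
        Sections.comap Y.hom (X ⊗ Y).hom (snd X Y).left (snd_left_comp_hom X Y)
          (prodFamilyRight_inf₃_le_snd X Y U W b b' b'') (c b b' b'') :=
  rfl

/-- **Base change commutes with `d⁰`.** [folklore] -/
theorem kunnethC1_lTensor_cechD0 (T : Sections X.hom U ⊗[k] CechC0 Y.hom W) :
    kunnethC1 X Y U W (LinearMap.lTensor _ (cechD0 Y.hom W) T) =
      cechD0 (X ⊗ Y).hom (prodFamilyRight X Y U W) (kunnethC0 X Y U W T) := by
  induction T using TensorProduct.induction_on with
  | zero => simp only [map_zero]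
  | tmul r e =>
      funext b b'
      rw [LinearMap.lTensor_tmul, kunnethC1_tmul, cechD0_apply, cechD0_apply, kunnethC0_tmul,
        kunnethC0_tmul, map_sub, map_mul, map_mul, mul_sub, Sections.res_comap,
        Sections.res_comap, Sections.res_comap, Sections.res_comap, Sections.comap_res,
        Sections.comap_res]
  | add x y hx hy => simp only [map_add, hx, hy]

/-- **Base change commutes with `d¹`.** [folklore] -/
theorem kunnethC2_lTensor_cechD1 (T : Sections X.hom U ⊗[k] CechC1 Y.hom W) :
    kunnethC2 X Y U W (LinearMap.lTensor _ (cechD1 Y.hom W) T) =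
      cechD1 (X ⊗ Y).hom (prodFamilyRight X Y U W) (kunnethC1 X Y U W T) := by
  induction T using TensorProduct.induction_on with
  | zero => simp only [map_zero]
  | tmul r c =>
      funext b b' b''
      rw [LinearMap.lTensor_tmul, kunnethC2_tmul, cechD1_apply, cechD1_apply, kunnethC1_tmul,
        kunnethC1_tmul, kunnethC1_tmul, map_add, map_sub, map_mul, map_mul, map_mul, mul_add,
        mul_sub, Sections.res_comap, Sections.res_comap, Sections.res_comap, Sections.res_comap,
        Sections.res_comap, Sections.res_comap, Sections.comap_res, Sections.comap_res,
        Sections.comap_res]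
  | add x y hx hy => simp only [map_add, hx, hy]

/-- `kunnethC1 (1 ⊗ c) = pr_Y^* c` restricted to `U ×_k 𝒲`: the refinement (along the identity
of `B`) of the pullback `snd^* c` on `pr_Y⁻¹𝒲`. [folklore] -/
theorem kunnethC1_one_tmul (c : CechC1 Y.hom W) :
    kunnethC1 X Y U W (1 ⊗ₜ c) =
      cechRefineC1 (X ⊗ Y).hom (preimageFamily (snd X Y).left W) (prodFamilyRight X Y U W) id
        (prodFamilyRight_le_snd X Y U W)
        (cechComapC1 Y.hom (X ⊗ Y).hom (snd X Y).left (snd_left_comp_hom X Y) W c) := by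
  funext b b'
  rw [kunnethC1_tmul, map_one, one_mul, cechRefineC1_apply, cechComapC1_apply]
  erw [Sections.res_comap]
  rfl

variable {U}

/-- **Naturality of `kunnethC1` in `U`**: for `U' ⊆ U`, base change after restricting to `U'`
is base change followed by the refinement `Č¹(U ×_k 𝒲) → Č¹(U' ×_k 𝒲)` (along the identity of
`B`). [folklore] -/
theorem kunnethC1_rTensor_res {U' : X.left.Opens} (hU' : U' ≤ U)
    (T : Sections X.hom U ⊗[k] CechC1 Y.hom W) :
    kunnethC1 X Y U' W (LinearMap.rTensor _ (Sections.res X.hom hU').toLinearMap T) =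
      cechRefineC1 (X ⊗ Y).hom (prodFamilyRight X Y U W) (prodFamilyRight X Y U' W) id
        (fun _ => prodOpen_mono X Y hU' le_rfl) (kunnethC1 X Y U W T) := by
  induction T using TensorProduct.induction_on with
  | zero => simp only [map_zero]
  | tmul r c =>
      funext b b'
      rw [LinearMap.rTensor_tmul, kunnethC1_tmul, cechRefineC1_apply, kunnethC1_tmul, map_mul,
        Sections.res_comap, Sections.res_comap]
      erw [Sections.comap_res]
      rfl
  | add x y hx hy => simp only [map_add, hx, hy]

variable (U)

/-- Intersections of affine opens of a quasi-separated scheme are quasi-compact. [folklore] -/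
theorem isCompact_inf [QuasiSeparatedSpace ↥Y.left] {W₁ W₂ : Y.left.Opens}
    (h₁ : IsCompact (W₁ : Set Y.left)) (h₂ : IsCompact (W₂ : Set Y.left)) :
    IsCompact ((W₁ ⊓ W₂ : Y.left.Opens) : Set Y.left) :=
  isQuasiSeparated_univ _ _ (Set.subset_univ _) W₁.isOpen h₁ (Set.subset_univ _) W₂.isOpen h₂

/-- **`Γ(U) ⊗_k Č¹(𝒲) → Č¹(U ×_k 𝒲)` is bijective** (`B` finite, `U` qcqs, the `W_b` affine opens
of the quasi-separated `Y`). [cite: GortzWedhorn2023, Cor. 22.110 (p. 399), i = 0] -/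
theorem kunnethC1_bijective [Finite B] [QuasiSeparatedSpace ↥Y.left]
    (hU : IsCompact (U : Set X.left)) (hU' : IsQuasiSeparated (U : Set X.left))
    (hW : ∀ b, IsAffineOpen (W b)) : Function.Bijective (kunnethC1 X Y U W) := by
  refine (LinearEquiv.bijective (piCurry₂ (fun b b' => Sections (X ⊗ Y).hom
      (prodFamilyRight X Y U W b ⊓ prodFamilyRight X Y U W b'))).symm).comp
    ((kunnethPi_bijective X Y U
    (fun p : B × B => W p.1 ⊓ W p.2)
    (fun p => prodFamilyRight X Y U W p.1 ⊓ prodFamilyRight X Y U W p.2)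
    (fun p => prodFamilyRight_inf_le_fst X Y U W p.1 p.2)
    (fun p => prodFamilyRight_inf_le_snd X Y U W p.1 p.2) hU hU'
    (fun p => isCompact_inf Y (hW p.1).isCompact (hW p.2).isCompact)
    (fun p => isQuasiSeparated_univ.of_subset (Set.subset_univ _))
    (fun p _ hx => ⟨⟨hx.1, hx.2.1⟩, ⟨hx.1, hx.2.2⟩⟩)).comp
    (LinearEquiv.bijective (LinearEquiv.lTensor (Sections X.hom U)
      (piCurry₂ (fun b b' => Sections Y.hom (W b ⊓ W b'))))))

/-- **`Γ(U) ⊗_k Č²(𝒲) → Č²(U ×_k 𝒲)` is injective** (indeed bijective).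
[cite: GortzWedhorn2023, Cor. 22.110 (p. 399), i = 0] -/
theorem kunnethC2_injective [Finite B] [QuasiSeparatedSpace ↥Y.left]
    (hU : IsCompact (U : Set X.left)) (hU' : IsQuasiSeparated (U : Set X.left))
    (hW : ∀ b, IsAffineOpen (W b)) : Function.Injective (kunnethC2 X Y U W) := by
  refine (LinearEquiv.injective (piCurry₃ (fun b b' b'' => Sections (X ⊗ Y).hom
      (prodFamilyRight X Y U W b ⊓ prodFamilyRight X Y U W b' ⊓
        prodFamilyRight X Y U W b''))).symm).comp
    ((kunnethPi_bijective X Y U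
    (fun p : B × B × B => W p.1 ⊓ W p.2.1 ⊓ W p.2.2)
    (fun p => prodFamilyRight X Y U W p.1 ⊓ prodFamilyRight X Y U W p.2.1 ⊓
      prodFamilyRight X Y U W p.2.2)
    (fun p => prodFamilyRight_inf₃_le_fst X Y U W p.1 p.2.1 p.2.2)
    (fun p => prodFamilyRight_inf₃_le_snd X Y U W p.1 p.2.1 p.2.2) hU hU'
    (fun p => isCompact_inf Y (isCompact_inf Y (hW p.1).isCompact (hW p.2.1).isCompact)
      (hW p.2.2).isCompact)
    (fun p => isQuasiSeparated_univ.of_subset (Set.subset_univ _))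
    (fun p _ hx => ⟨⟨⟨hx.1, hx.2.1.1⟩, ⟨hx.1, hx.2.1.2⟩⟩, ⟨hx.1, hx.2.2⟩⟩)).1.comp
    (LinearEquiv.injective (LinearEquiv.lTensor (Sections X.hom U)
      (piCurry₃ (fun b b' b'' => Sections Y.hom (W b ⊓ W b' ⊓ W b''))))))

end Cech

end Literature.AlgebraicGeometry.Motives

end
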